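import Summits.Ventures.PercRepro.S2LPColoops

/-!
# PercRepro — THE CONSTANTS `Φ(p, 5)`, `7 ≤ p ≤ 14`, AS RATIONALS (p2, gen 30; the level-5 coloop/closure LP, SUBCLAIM-S2 feeder)

`Φ(p, 5) = Σ_{5<u<p} C(p+5, u) / C(p+5, p)` evaluated for the rows of the window, and the lossy-ladder bounds
`Φ(p, 5) ≤ 2(2^c − 1)` that retire the cells with many coloops. Nothing is claimed about any cell.

* `phiK_seven_five` … `phiK_fourteen_five`.
Axioms: standard.
-/

open scoped Matroid

namespace PercRepro

namespace S2LP

/-- `Φ(7, 5) = 7 / 6` exactly. -/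
theorem phiK_seven_five : phiK 7 5 = 7 / 6 := by
  unfold phiK
  rw [show Finset.Ioo 5 7 = {6} from by decide, Finset.sum_singleton]
  norm_num [Nat.choose]

/-- `Φ(8, 5) = 8 / 3` exactly. -/
theorem phiK_eight_five : phiK 8 5 = 8 / 3 := by
  unfold phiK
  rw [show Finset.Ioo 5 8 = Finset.Icc 6 7 from rfl]
  simp only [Finset.sum_Icc_succ_top (show 6 ≤ 7 by norm_num), Finset.Icc_self, Finset.sum_singleton]
  norm_num [Nat.choose]

/-- `Φ(9, 5) = 33 / 7` exactly. -/
theorem phiK_nine_five : phiK 9 5 = 33 / 7 := by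
  unfold phiK
  rw [show Finset.Ioo 5 9 = Finset.Icc 6 8 from rfl]
  simp only [Finset.sum_Icc_succ_top (show 6 ≤ 8 by norm_num), Finset.sum_Icc_succ_top (show 6 ≤ 7 by norm_num), Finset.Icc_self, Finset.sum_singleton]
  norm_num [Nat.choose]

/-- `Φ(10, 5) = 160 / 21` exactly. -/
theorem phiK_ten_five : phiK 10 5 = 160 / 21 := by
  unfold phiK
  rw [show Finset.Ioo 5 10 = Finset.Icc 6 9 from rfl]
  simp only [Finset.sum_Icc_succ_top (show 6 ≤ 9 by norm_num), Finset.sum_Icc_succ_top (show 6 ≤ 8 by norm_num), Finset.sum_Icc_succ_top (show 6 ≤ 7 by norm_num), Finset.Icc_self, Finset.sum_singleton]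
  norm_num [Nat.choose]

/-- `Φ(11, 5) = 1991 / 168` exactly. -/
theorem phiK_eleven_five : phiK 11 5 = 1991 / 168 := by
  unfold phiK
  rw [show Finset.Ioo 5 11 = Finset.Icc 6 10 from rfl]
  simp only [Finset.sum_Icc_succ_top (show 6 ≤ 10 by norm_num), Finset.sum_Icc_succ_top (show 6 ≤ 9 by norm_num), Finset.sum_Icc_succ_top (show 6 ≤ 8 by norm_num), Finset.sum_Icc_succ_top (show 6 ≤ 7 by norm_num), Finset.Icc_self, Finset.sum_singleton]
  norm_num [Nat.choose]

/-- `Φ(12, 5) = 127 / 7` exactly. -/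
theorem phiK_twelve_five : phiK 12 5 = 127 / 7 := by
  unfold phiK
  rw [show Finset.Ioo 5 12 = Finset.Icc 6 11 from rfl]
  simp only [Finset.sum_Icc_succ_top (show 6 ≤ 11 by norm_num), Finset.sum_Icc_succ_top (show 6 ≤ 10 by norm_num), Finset.sum_Icc_succ_top (show 6 ≤ 9 by norm_num), Finset.sum_Icc_succ_top (show 6 ≤ 8 by norm_num), Finset.sum_Icc_succ_top (show 6 ≤ 7 by norm_num), Finset.Icc_self, Finset.sum_singleton]
  norm_num [Nat.choose]

/-- `Φ(13, 5) = 1742 / 63` exactly. -/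
theorem phiK_thirteen_five : phiK 13 5 = 1742 / 63 := by
  unfold phiK
  rw [show Finset.Ioo 5 13 = Finset.Icc 6 12 from rfl]
  simp only [Finset.sum_Icc_succ_top (show 6 ≤ 12 by norm_num), Finset.sum_Icc_succ_top (show 6 ≤ 11 by norm_num), Finset.sum_Icc_succ_top (show 6 ≤ 10 by norm_num), Finset.sum_Icc_succ_top (show 6 ≤ 9 by norm_num), Finset.sum_Icc_succ_top (show 6 ≤ 8 by norm_num), Finset.sum_Icc_succ_top (show 6 ≤ 7 by norm_num), Finset.Icc_self, Finset.sum_singleton]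
  norm_num [Nat.choose]

/-- `Φ(14, 5) = 380 / 9` exactly. -/
theorem phiK_fourteen_five : phiK 14 5 = 380 / 9 := by
  unfold phiK
  rw [show Finset.Ioo 5 14 = Finset.Icc 6 13 from rfl]
  simp only [Finset.sum_Icc_succ_top (show 6 ≤ 13 by norm_num), Finset.sum_Icc_succ_top (show 6 ≤ 12 by norm_num), Finset.sum_Icc_succ_top (show 6 ≤ 11 by norm_num), Finset.sum_Icc_succ_top (show 6 ≤ 10 by norm_num), Finset.sum_Icc_succ_top (show 6 ≤ 9 by norm_num), Finset.sum_Icc_succ_top (show 6 ≤ 8 by norm_num), Finset.sum_Icc_succ_top (show 6 ≤ 7 by norm_num), Finset.Icc_self, Finset.sum_singleton]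
  norm_num [Nat.choose]

end S2LP

end PercRepro
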